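import Summits.QuantumFields.YangMills.Theorems.RationalShortRootRigidityNoU3Rescaling
import HarnessLib

/-!
# `RationalShortRootRigidity` — Step (2d): the no-`u₃` lemma (m9) `NoU3Lemma` — PROVED

Helper lemma INSIDE the paper proof of crux `stmt-QuantumFields-23124` (`F4SubCurvatureDoor.RationalShortRootRigidity`,
LINE g15-A of planner ym-idea-3; Step (2d), «the heart of the planar lemma»; free-hands menu III, item (m9), statement typed
in HOME l15/Helpers23124b.lean as `Helpers.NoU3Lemma` — proved here DEF-FREE with that body verbatim, following the owner's
Lean plan HOME l15/STUB-PLAN-NoU3Lemma.md):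

**Lemma** (`noU3Lemma`).  Let `b = Σ_{(i,j)∈S} c_ij u₂^i u₃^j` with `c_(k,0) ≠ 0` and every other support point satisfying
`2i + 3j ≤ 2k − 1`.  If for EVERY real `y` all complex roots `z` of `Q_y(z) = Σ c_ij z^i (3zy − 4y³)^j` are real, then
`c_ij = 0` whenever `j ≥ 1`.

Proof (assembly).  §0: restrict to `S' = {c ≠ 0}`.  §1: the critical ratio `a/b` = the maximum of `j/(k−i)` over the terms
with `j ≥ 1` (`Finset.exists_max_image`), in lowest terms; `3a < 2b`, so `b ≥ 2`; maximality reads `j·b ≤ a·(k−i)` on `S'`.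
Part II (`topWeight_roots_real`, p-NoU3Rescaling) applied to `c` and to `c' = (−1)^j c` (the substitution `y ↦ −y`) shows that
the two top-weight polynomials `Σ_{jb = a(k−i)} c_ij (∓4)^j W^i` have only real roots.  The top-weight terms are
`(i,j) = (k − bm, am)`, `0 ≤ m ≤ M` (`exists_mul_of_topWeight`, coprimality), and re-indexing by `m` (`Finset.sum_nbij'`) puts
them in the form of part I's `noU3_contradiction` (p666655), which yields `False`.

Mathlib + the tree files of parts I/II; THEOREMS ONLY (no definitions); no named facts; no `sorry`; default heartbeats.
Nothing about the crux 23124 (which needs the rest of Step 2 and Steps 1, 4), the route's rung or the Yang–Mills mass gap is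
proved here.  Free-hands seat `ym-line-frs-p2` g10, `--supports stmt-QuantumFields-23124`.
-/

set_option autoImplicit false

namespace Summit.QuantumFields.YangMills.Theorems.RationalShortRootRigidity

open Polynomial
open scoped BigOperators Polynomial

/-- Structure of the top-weight support points: `j·b = a·(k−i)` with `a, b` coprime, `a ≥ 1`, `i ≤ k` forces
`(i,j) = (k − bm, am)` with `bm ≤ k`. [folklore] -/
theorem exists_mul_of_topWeight (a b k i j : ℕ) (hab : Nat.Coprime a b) (ha : 1 ≤ a) (hik : i ≤ k)
    (h : j * b = a * (k - i)) : ∃ m : ℕ, j = a * m ∧ i = k - b * m ∧ b * m ≤ k := by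
  have hdvd : a ∣ j := hab.dvd_of_dvd_mul_right ⟨k - i, h⟩
  obtain ⟨m, rfl⟩ := hdvd
  refine ⟨m, rfl, ?_, ?_⟩
  · have h1 : a * (m * b) = a * (k - i) := by rw [← h]; ring
    have h2 : m * b = k - i := Nat.eq_of_mul_eq_mul_left ha h1
    rw [mul_comm] at h2
    omega
  · have h1 : a * (m * b) = a * (k - i) := by rw [← h]; ring
    have h2 : m * b = k - i := Nat.eq_of_mul_eq_mul_left ha h1
    rw [mul_comm] at h2
    omega

/-- **The no-`u₃` lemma** (m9; Step (2d) of the paper proof of 23124, the heart of the planar lemma).  The statement is the body of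
`Helpers.NoU3Lemma` (HOME l15/Helpers23124b.lean) verbatim. [folklore] -/
theorem noU3Lemma :
    ∀ (k : ℕ) (S : Finset (ℕ × ℕ)) (c : ℕ × ℕ → ℝ),
      (k, 0) ∈ S → c (k, 0) ≠ 0 →
      (∀ ij ∈ S, ij ≠ (k, 0) → 2 * ij.1 + 3 * ij.2 + 1 ≤ 2 * k) →
      (∀ y : ℝ, ∀ z : ℂ,
          (∑ ij ∈ S, (c ij : ℂ) * z ^ ij.1 * (3 * z * (y : ℂ) - 4 * (y : ℂ) ^ 3) ^ ij.2) = 0 → z.im = 0) →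
      ∀ ij ∈ S, 1 ≤ ij.2 → c ij = 0 := by
  intro k S c hk0 hc0 hsupp hW
  by_contra hcon
  obtain ⟨ij₀, hij₀S, hj₀, hc₀⟩ : ∃ ij ∈ S, 1 ≤ ij.2 ∧ c ij ≠ 0 := by
    by_contra h'
    exact hcon fun ij hij hj => by_contra fun hc => h' ⟨ij, hij, hj, hc⟩
  -- §0. restrict to the non-zero coefficients
  obtain ⟨S', hS'⟩ : ∃ S' : Finset (ℕ × ℕ), S' = S.filter (fun ij => c ij ≠ 0) := ⟨_, rfl⟩
  have hmemS' : ∀ ij, ij ∈ S' ↔ ij ∈ S ∧ c ij ≠ 0 := fun ij => by rw [hS', Finset.mem_filter]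
  have hk0' : (k, 0) ∈ S' := (hmemS' _).2 ⟨hk0, hc0⟩
  have hsupp' : ∀ ij ∈ S', ij ≠ (k, 0) → 2 * ij.1 + 3 * ij.2 + 1 ≤ 2 * k :=
    fun ij hij => hsupp ij ((hmemS' ij).1 hij).1
  have hik' : ∀ ij ∈ S', ij.1 ≤ k := by
    intro ij hij
    by_cases h : ij = (k, 0)
    · rw [h]
    · have := hsupp' ij hij h; omega
  have hsumS' : ∀ F : ℕ × ℕ → ℂ, (∀ ij, c ij = 0 → F ij = 0) → ∑ ij ∈ S', F ij = ∑ ij ∈ S, F ij := by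
    intro F hF
    rw [hS']
    exact Finset.sum_filter_of_ne fun ij _ hne hc => hne (hF ij hc)
  have hW' : ∀ y : ℝ, ∀ z : ℂ,
      (∑ ij ∈ S', (c ij : ℂ) * z ^ ij.1 * (3 * z * (y : ℂ) - 4 * (y : ℂ) ^ 3) ^ ij.2) = 0 → z.im = 0 := by
    intro y z h
    rw [hsumS' (fun ij => (c ij : ℂ) * z ^ ij.1 * (3 * z * (y : ℂ) - 4 * (y : ℂ) ^ 3) ^ ij.2)
      (fun ij hc => by rw [hc, Complex.ofReal_zero, zero_mul, zero_mul])] at h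
    exact hW y z h
  -- the sign-twisted coefficients `c' = (−1)^j c` (the substitution `y ↦ −y`)
  have hW'' : ∀ y : ℝ, ∀ z : ℂ,
      (∑ ij ∈ S', (((-1) ^ ij.2 * c ij : ℝ) : ℂ) * z ^ ij.1 * (3 * z * (y : ℂ) - 4 * (y : ℂ) ^ 3) ^ ij.2) = 0 →
        z.im = 0 := by
    intro y z h
    rw [hsumS' (fun ij => (((-1) ^ ij.2 * c ij : ℝ) : ℂ) * z ^ ij.1 * (3 * z * (y : ℂ) - 4 * (y : ℂ) ^ 3) ^ ij.2)
      (fun ij hc => by rw [hc, mul_zero, Complex.ofReal_zero, zero_mul, zero_mul])] at h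
    apply hW (-y) z
    rw [← h]
    refine Finset.sum_congr rfl fun ij _ => ?_
    push_cast
    rw [show (3 * z * -(y : ℂ) - 4 * (-(y : ℂ)) ^ 3) = -(3 * z * (y : ℂ) - 4 * (y : ℂ) ^ 3) by ring, neg_pow]
    ring
  -- §1. the critical ratio
  obtain ⟨E', hE'⟩ : ∃ E' : Finset (ℕ × ℕ), E' = S'.filter (fun ij => 1 ≤ ij.2) := ⟨_, rfl⟩
  have hmemE' : ∀ ij, ij ∈ E' ↔ ij ∈ S' ∧ 1 ≤ ij.2 := fun ij => by rw [hE', Finset.mem_filter]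
  have hE'ne : E'.Nonempty := ⟨ij₀, (hmemE' _).2 ⟨(hmemS' _).2 ⟨hij₀S, hc₀⟩, hj₀⟩⟩
  have hE'lt : ∀ ij ∈ E', ij.1 + 2 ≤ k := by
    intro ij hij
    obtain ⟨hij', hj⟩ := (hmemE' ij).1 hij
    have hne : ij ≠ (k, 0) := by rintro rfl; exact absurd hj (by simp)
    have := hsupp' ij hij' hne
    omega
  obtain ⟨ijs, hijs, hmaxQ⟩ := Finset.exists_max_image E' (fun ij : ℕ × ℕ => (ij.2 : ℚ) / ((k : ℚ) - ij.1)) hE'ne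
  obtain ⟨hijsS', hjs⟩ := (hmemE' ijs).1 hijs
  have hiks : ijs.1 + 2 ≤ k := hE'lt ijs hijs
  -- cross-multiplied maximality
  have hmaxN : ∀ ij ∈ E', ij.2 * (k - ijs.1) ≤ ijs.2 * (k - ij.1) := by
    intro ij hij
    have hik : ij.1 + 2 ≤ k := hE'lt ij hij
    have h := hmaxQ ij hij
    rw [div_le_div_iff₀ (by rw [← Nat.cast_sub (by omega)]; exact_mod_cast (show 0 < k - ij.1 by omega))
      (by rw [← Nat.cast_sub (by omega)]; exact_mod_cast (show 0 < k - ijs.1 by omega))] at h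
    rw [← Nat.cast_sub (show ijs.1 ≤ k by omega), ← Nat.cast_sub (show ij.1 ≤ k by omega)] at h
    exact_mod_cast h
  -- lowest terms `a / b`
  obtain ⟨g, hg⟩ : ∃ g : ℕ, g = Nat.gcd ijs.2 (k - ijs.1) := ⟨_, rfl⟩
  have hgpos : 0 < g := by rw [hg]; exact Nat.gcd_pos_of_pos_left _ hjs
  obtain ⟨a, ha⟩ : ∃ a : ℕ, a = ijs.2 / g := ⟨_, rfl⟩
  obtain ⟨b, hb⟩ : ∃ b : ℕ, b = (k - ijs.1) / g := ⟨_, rfl⟩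
  have hag : a * g = ijs.2 := by rw [ha, hg]; exact Nat.div_mul_cancel (Nat.gcd_dvd_left _ _)
  have hbg : b * g = k - ijs.1 := by rw [hb, hg]; exact Nat.div_mul_cancel (Nat.gcd_dvd_right _ _)
  have hab : Nat.Coprime a b := by rw [ha, hb, hg]; exact Nat.coprime_div_gcd_div_gcd (hg ▸ hgpos)
  have ha1 : 1 ≤ a := by
    rcases Nat.eq_zero_or_pos a with h | h
    · exfalso; rw [h, zero_mul] at hag; omega
    · exact h
  have h3a : 3 * a < 2 * b := by
    have hne : ijs ≠ (k, 0) := by rintro h; rw [h] at hjs; exact absurd hjs (by simp)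
    have h1 := hsupp' ijs hijsS' hne
    have h2 : 3 * ijs.2 < 2 * (k - ijs.1) := by omega
    rw [← hag, ← hbg] at h2
    nlinarith
  have hb2 : 2 ≤ b := by omega
  have hmax : ∀ ij ∈ S', 1 ≤ ij.2 → ij.2 * b ≤ a * (k - ij.1) := by
    intro ij hij hj
    have h1 := hmaxN ij ((hmemE' ij).2 ⟨hij, hj⟩)
    rw [← hag, ← hbg] at h1
    have h2 : (ij.2 * b) * g ≤ (a * (k - ij.1)) * g := by
      calc (ij.2 * b) * g = ij.2 * (b * g) := by ring
        _ ≤ a * g * (k - ij.1) := h1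
        _ = (a * (k - ij.1)) * g := by ring
    exact Nat.le_of_mul_le_mul_right h2 hgpos
  -- §1'. the top-weight polynomials for `c` and for `c'` have only real roots (part II)
  have hplus_ij := topWeight_roots_real S' c k a b hk0' hc0 h3a hsupp' hmax hW'
  have hminus_ij := topWeight_roots_real S' (fun ij => (-1) ^ ij.2 * c ij) k a b hk0' (by simpa using hc0) h3a hsupp'
    hmax hW''
  -- §2. re-index the top-weight terms by `m`: `(i,j) = (k − bm, am)`, `m ≤ M`
  obtain ⟨T, hT⟩ : ∃ T : Finset (ℕ × ℕ), T = S'.filter (fun ij => ij.2 * b = a * (k - ij.1)) := ⟨_, rfl⟩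
  have hmemT : ∀ ij, ij ∈ T ↔ ij ∈ S' ∧ ij.2 * b = a * (k - ij.1) := fun ij => by rw [hT, Finset.mem_filter]
  have hk0T : (k, 0) ∈ T := (hmemT _).2 ⟨hk0', by simp⟩
  obtain ⟨ijM, hijM, hMax⟩ := Finset.exists_max_image T (fun ij : ℕ × ℕ => ij.2) ⟨(k, 0), hk0T⟩
  obtain ⟨hijMS', hijMeq⟩ := (hmemT ijM).1 hijM
  obtain ⟨M, hjM, hiM, hkM⟩ := exists_mul_of_topWeight a b k ijM.1 ijM.2 hab ha1 (hik' ijM hijMS') hijMeq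
  have hijsT : ijs ∈ T := (hmemT _).2 ⟨hijsS', by rw [← hag, ← hbg]; ring⟩
  have hM1 : 1 ≤ M := by
    have h1 : ijs.2 ≤ ijM.2 := hMax ijs hijsT
    rcases Nat.eq_zero_or_pos M with h | h
    · exfalso; rw [h, mul_zero] at hjM; omega
    · exact h
  have hT_struct : ∀ ij ∈ T, ∃ m, m ≤ M ∧ ij = (k - b * m, a * m) := by
    intro ij hij
    obtain ⟨hijS', hijeq⟩ := (hmemT ij).1 hij
    obtain ⟨m, hjm, him, -⟩ := exists_mul_of_topWeight a b k ij.1 ij.2 hab ha1 (hik' ij hijS') hijeq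
    refine ⟨m, ?_, Prod.ext him hjm⟩
    have h1 : ij.2 ≤ ijM.2 := hMax ij hij
    rw [hjm, hjM] at h1
    exact Nat.le_of_mul_le_mul_left h1 ha1
  -- the re-indexing identity
  have hreindex : ∀ ε w : ℂ,
      (∑ m ∈ Finset.range (M + 1),
        (((fun m => if (k - b * m, a * m) ∈ S' then c (k - b * m, a * m) else 0) m : ℝ) : ℂ) *
          ε ^ (a * m) * w ^ (k - b * m)) =
      ∑ ij ∈ S', (if ij.2 * b = a * (k - ij.1) then (c ij : ℂ) * ε ^ ij.2 else 0) * w ^ ij.1 := by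
    intro ε w
    have hR : (∑ m ∈ Finset.range (M + 1),
        (((fun m => if (k - b * m, a * m) ∈ S' then c (k - b * m, a * m) else 0) m : ℝ) : ℂ) *
          ε ^ (a * m) * w ^ (k - b * m)) =
        ∑ m ∈ (Finset.range (M + 1)).filter (fun m => (k - b * m, a * m) ∈ S'),
          (c (k - b * m, a * m) : ℂ) * ε ^ (a * m) * w ^ (k - b * m) := by
      rw [Finset.sum_filter]
      refine Finset.sum_congr rfl fun m _ => ?_
      by_cases h : (k - b * m, a * m) ∈ S'
      · simp only [h, if_true]
      · simp only [h, if_false, Complex.ofReal_zero, zero_mul]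
    have hTsum : (∑ ij ∈ S', (if ij.2 * b = a * (k - ij.1) then (c ij : ℂ) * ε ^ ij.2 else 0) * w ^ ij.1) =
        ∑ ij ∈ T, (c ij : ℂ) * ε ^ ij.2 * w ^ ij.1 := by
      rw [hT, Finset.sum_filter]
      refine Finset.sum_congr rfl fun ij _ => ?_
      by_cases h : ij.2 * b = a * (k - ij.1)
      · rw [if_pos h, if_pos h]
      · rw [if_neg h, if_neg h, zero_mul]
    rw [hR, hTsum]
    refine Finset.sum_nbij' (fun m => (k - b * m, a * m)) (fun ij => ij.2 / a) ?_ ?_ ?_ ?_ ?_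
    · intro m hm
      rw [Finset.mem_filter] at hm
      obtain ⟨hm1, hm2⟩ := hm
      have hmM : m ≤ M := Nat.lt_succ_iff.1 (Finset.mem_range.1 hm1)
      refine (hmemT _).2 ⟨hm2, ?_⟩
      have h1 : b * m ≤ k := (Nat.mul_le_mul_left b hmM).trans hkM
      show a * m * b = a * (k - (k - b * m))
      rw [Nat.sub_sub_self h1]; ring
    · intro ij hij
      obtain ⟨m, hmM, rfl⟩ := hT_struct ij hij
      rw [Finset.mem_filter, Finset.mem_range]
      refine ⟨?_, ?_⟩
      · show a * m / a < M + 1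
        rw [Nat.mul_div_cancel_left m ha1]; omega
      · show (k - b * (a * m / a), a * (a * m / a)) ∈ S'
        rw [Nat.mul_div_cancel_left m ha1]; exact ((hmemT _).1 hij).1
    · intro m _
      show a * m / a = m
      exact Nat.mul_div_cancel_left m ha1
    · intro ij hij
      obtain ⟨m, hmM, rfl⟩ := hT_struct ij hij
      show (k - b * (a * m / a), a * (a * m / a)) = (k - b * m, a * m)
      rw [Nat.mul_div_cancel_left m ha1]
    · intro m _
      rfl
  -- §3. the contradiction of part I
  refine noU3_contradiction k a b M (fun m => if (k - b * m, a * m) ∈ S' then c (k - b * m, a * m) else 0)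
    hb2 hab hM1 hkM ?_ ?_ ?_ ?_
  · show (if (k - b * 0, a * 0) ∈ S' then c (k - b * 0, a * 0) else 0) ≠ 0
    rw [mul_zero, mul_zero, Nat.sub_zero, if_pos hk0']
    exact hc0
  · show (if (k - b * M, a * M) ∈ S' then c (k - b * M, a * M) else 0) ≠ 0
    rw [← hjM, ← hiM, Prod.mk.eta, if_pos hijMS']
    exact ((hmemS' ijM).1 hijMS').2
  · intro w hw
    rw [hreindex] at hw
    exact hplus_ij w hw
  · intro w hw
    rw [hreindex] at hw
    have heq : (∑ ij ∈ S', (if ij.2 * b = a * (k - ij.1) then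
        ((((-1 : ℝ) ^ ij.2 * c ij : ℝ)) : ℂ) * (-4) ^ ij.2 else 0) * w ^ ij.1) =
        ∑ ij ∈ S', (if ij.2 * b = a * (k - ij.1) then (c ij : ℂ) * 4 ^ ij.2 else 0) * w ^ ij.1 := by
      refine Finset.sum_congr rfl fun ij _ => ?_
      by_cases h : ij.2 * b = a * (k - ij.1)
      · rw [if_pos h, if_pos h]
        push_cast
        rw [show (4 : ℂ) = (-1) * (-4) by norm_num, mul_pow]
        ring
      · rw [if_neg h, if_neg h]
    apply hminus_ij w
    rw [heq]
    exact hw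

end Summit.QuantumFields.YangMills.Theorems.RationalShortRootRigidity
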